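import Summits.BirchSwinnertonDyer.BirchSwinnertonDyer.Theorems.Rank1ResidualJetCarrierMultKitOrder
import HarnessLib

/-!
# T1 JET (cell `bsd-jet`), bucket B-mult at `p ≥ 5` (carrier `q = p`, `E` SPLIT MULTIPLICATIVE at `p`):
# SAMPLE by-name record `280b1` at `p = 5` through ALL THREE kit roads (S = Serre witnesses, R = (ram)
# witness, O = order-`p` witness)

HONEST FRAMING (programme file §HONESTY, verbatim): «no tranche here proves BSD; ARM L moves the
LITERAL column of an r ≤ 1 census into the kernel-proved-modulo-named-print column». THEOREMS ONLY
(seat `bsd-jet-pv-2`, session g2; `--supports stmt-BirchSwinnertonDyer-14418`, helper). PURPOSE: the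
worked TEMPLATE (for the row generator, seat `bsd-jet-ty`) of the bucket-B-mult roads AT `p ≥ 5` —
road S `JET.bsdp_of_jetRowCarrierMult_of_serreWitnesses` and road R `JET.bsdp_of_jetRowCarrierMult_of_ram`
(`Rank1ResidualJetCarrierMultKit.lean`, g0) and road O `JET.bsdp_of_jetRowCarrierMult_of_irr_of_order`
(`Rank1ResidualJetCarrierMultKitOrder.lean`) — on ONE census row of `HOME/census-jet/jet_keys_B_classes.tsv`
4c8599cf93bc5459 (18 542 bucket-B cells have `p ≥ 5`, all split multiplicative at `p`, `r = 1`;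
witness columns of the kit table `HOME/sheets/pv2-B5-witness/`, job «jetB-p5plus-witness»): `280b1`
(`p = 5`, B, split `I₅` at `5`, `c₅ = 5`, `r = 1`, `D = −31`, `ord₅ I_K = 1`), companion of
`Rank1ResidualJetCarrierMultRecords01.lean` (the `p = 3` rows). It is also the ANTI-VACUITY check of the
three kits' numeric hypotheses at a `p ≥ 5` on real data (every `decide`/`norm_num` goal below closes).
The Heegner datum (`K`, `N`, `P`), the index line `ord₅ [E(K):ℤP] ≤ ord₅ c₅` and `#Ш_an` stay
DISPLAYED binders, as do the READING binder `hJ : JET.JetchevDivisibilityCarrierMult` (audit sheet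
`HOME/sheets/PV2-B-GAP.md`; referee C R385: GAPPED-in-print, gap closed BY NAME) and the published
`hMcU`, `hGZK`, `hKo`, `hrec`, `hD36`, `hlev`. CONDITIONAL; nothing is booked; 0 classes move.

Numeric data (Cremona `allcurves`, recomputed in the kernel below): `280b1 = [0,0,0,−412,3316]`,
`N = 280 = 2³·5·7`, `Δ = −274400000 = −2⁸·5⁵·7³`, `c₄ = 19776`, `c₆ = −2865024`; `#Ẽ(𝔽₃) = 7`
(`a₃ = −3`), `#Ẽ(𝔽₁₇) = 25` (`a₁₇ = −7`), `#Ẽ(𝔽₁₀₁) = 120` (`a₁₀₁ = −18`).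

References: [Jetchev2008] Cor. 1.5 (p. 812); [Cremona2006] Table 1; [Serre1972] §2.4 Prop. 15, §2.8
Prop. 19; [Mazur1978] Prop. 6.3 (1); [Kraus1989] Prop. 1–2; [Wuthrich2014] Lemma 20.
-/

set_option autoImplicit false

noncomputable section

open scoped Classical

open WeierstrassCurve Literature.NumberTheory.EllipticCurves
  Literature.NumberTheory.EllipticCurves.ModularForms
  Literature.NumberTheory.EllipticCurves.Rank1Residual
  Literature.NumberTheory.EllipticCurves.Rank1Residual.X11RankOneCertificates
  Summit.BirchSwinnertonDyer.BirchSwinnertonDyer.Rank1Residual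
  Summit.BirchSwinnertonDyer.BirchSwinnertonDyer.Rank1Residual.IntModel
  Summit.BirchSwinnertonDyer.BirchSwinnertonDyer.Rank1Residual.X11RankOne
  Summit.BirchSwinnertonDyer.Rank1Residual Summit.BirchSwinnertonDyer.Rank1Residual.X11b

namespace Summit.BirchSwinnertonDyer.Rank1Residual.JET

/-- **`BSD(E,5)` for `280b1` through the bucket-B-mult kit, road S (Serre's Prop. 19 witnesses)**
(`N = 280 = 2³·5·7`; model `[0,0,0,−412,3316]`, `Δ = −2⁸·5⁵·7³`, `c₄ = 19776`; SPLIT MULTIPLICATIVE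
(`I₅`) at `5` with `c₅ = 5` — the CARRIER is `5` itself; `r_an = 1`). Kernel: `Δ ≠ 0`, support
`[(2,3,8),(5,1,5),(7,1,3)]` with the Kraus test at each prime, `5 ∣ Δ`, `5 ∤ c₄`, Serre witnesses
`(17, 25)` (`a₁₇ = −7 ≡ 3`, `a² − 4·17 ≡ 1` a non-zero square mod `5`: split Cartan element),
`(3, 7)` (`a₃ = −3 ≡ 2`, `a² − 12 ≡ 2` a non-square: non-split element), `(3, 7)` again with
`u = a²/3 ≡ 3 (mod 5)`, `u ∉ {0,1,2,4}`, `u² − 3u + 1 ≡ 1 ≠ 0`; the `5`-adic tower by the Tate line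
inside the kit. Displayed binders: `hJ` (READING K3), `hMcU`, `hGZK`, `hKo`, `hrec`, `hD36`, `hlev`
(published), the Heegner datum and the index line AT THE CARRIER `5`. CONDITIONAL; nothing booked.
[cite: Jetchev2008, Cor. 1.5 (p. 812)] [cite: Cremona2006, Table 1 (label 280b1)]
[cite: Serre1972, §2.8 Prop. 19] -/
theorem bsdp_jetBmult_280b1_5_serre
    (hJ : JetchevDivisibilityCarrierMult)
    (hMcU : McCallum1991_padicValNat_card_sha_primary_add_le_of_globalDivisibility)
    (hGZK : rank_eq_analyticRank_of_analyticRank_le_one)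
    (hKo : ∀ (N : ℕ) [NeZero N] (W : WeierstrassCurve ℚ) (K : Type) [Field K] [NumberField K],
      kolyvagin N W K)
    (hrec : ∀ (N : ℕ) [NeZero N] (W : WeierstrassCurve ℚ) (K : Type) [Field K] [NumberField K],
      heegnerPointOfConductor_one_galoisConj N W K)
    (hD36 : ∀ (N : ℕ) [NeZero N] (W : WeierstrassCurve ℚ) (K : Type) [Field K] [NumberField K],
      phi_heegnerTau_mem_singularModuliField N W K)
    (hlev : ∀ {N : ℕ} [NeZero N], IsNewformOf.level_eq_conductorNorm (N := N))
    (W : WeierstrassCurve ℚ) (hW : W = ⟨0, 0, 0, -412, 3316⟩)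
    {N : ℕ} [NeZero N] {K : Type} [Field K] [NumberField K] (hK : IsImaginaryQuadratic K)
    (hD3 : NumberField.discr K ≠ -3) (hD4 : NumberField.discr K ≠ -4)
    (hH : SatisfiesHeegnerHypothesis N K) {P : (W.baseChange K).toAffine.Point}
    (hP : IsHeegnerPoint N W K P) (hnt : ¬ IsOfFinAddOrder P)
    (hI : padicValNat 5 (AddSubgroup.zmultiples P).index ≤
      padicValNat 5 ((W.baseChange ℚ_[5]).localTamagawaNumber ℤ_[5]))
    (hr : W.analyticRank ≤ 1) {s : ℚ} (hs : shaAn W = (s : ℂ)) (hv : padicValRat 5 s = 0) :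
    BSDp W 5 :=
  bsdp_of_jetRowCarrierMult_of_serreWitnesses 5 Nat.prime_five (by norm_num) 0 0 0 (-412) 3316
    (by decide +kernel) [(2, 3, 8), (5, 1, 5), (7, 1, 3)]
    (by intro t ht; simp only [List.mem_cons, List.not_mem_nil, or_false] at ht
        rcases ht with rfl | rfl | rfl <;> norm_num)
    (by decide +kernel) (by decide +kernel) (by decide +kernel) (by decide +kernel)
    17 3 3 (by norm_num) (by norm_num) (by norm_num) (by norm_num) (by norm_num) (by norm_num)
    (by norm_num) (by norm_num) (by norm_num) (by decide +kernel) (by decide +kernel) (by decide +kernel)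
    (n₁ := 25) (n₂ := 7) (n₃ := 7) (by decide +kernel) (by decide +kernel) (by decide +kernel)
    (by decide +kernel) (by decide +kernel) (by decide +kernel) hJ hMcU hGZK hKo hrec hD36 hlev W hW hK
    hD3 hD4 hH hP hnt hI hr hs hv

/-- **`BSD(E,5)` for `280b1` through the bucket-B-mult kit, road R** (same pair; image from the
Frobenius witness `(3, 7)` irreducible mod `5` (`a₃ = −3`, `X² + 3X + 3` root-free mod `5`) and the
(ram) witness `m = 7` (`7³ ∥ Δ`, `7 ∤ c₄`, `5 ∤ 3`); tower by the Tate line inside the kit).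
Displayed binders as in `bsdp_jetBmult_280b1_5_serre`. CONDITIONAL; nothing booked.
[cite: Jetchev2008, Cor. 1.5 (p. 812)] [cite: Cremona2006, Table 1 (label 280b1)]
[cite: Mazur1978, §6 Prop. 6.3 (1) (p. 153)] [cite: Wuthrich2014, Lemma 20 (p. 399)] -/
theorem bsdp_jetBmult_280b1_5_ram
    (hJ : JetchevDivisibilityCarrierMult)
    (hMcU : McCallum1991_padicValNat_card_sha_primary_add_le_of_globalDivisibility)
    (hGZK : rank_eq_analyticRank_of_analyticRank_le_one)
    (hKo : ∀ (N : ℕ) [NeZero N] (W : WeierstrassCurve ℚ) (K : Type) [Field K] [NumberField K],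
      kolyvagin N W K)
    (hrec : ∀ (N : ℕ) [NeZero N] (W : WeierstrassCurve ℚ) (K : Type) [Field K] [NumberField K],
      heegnerPointOfConductor_one_galoisConj N W K)
    (hD36 : ∀ (N : ℕ) [NeZero N] (W : WeierstrassCurve ℚ) (K : Type) [Field K] [NumberField K],
      phi_heegnerTau_mem_singularModuliField N W K)
    (hlev : ∀ {N : ℕ} [NeZero N], IsNewformOf.level_eq_conductorNorm (N := N))
    (W : WeierstrassCurve ℚ) (hW : W = ⟨0, 0, 0, -412, 3316⟩)
    {N : ℕ} [NeZero N] {K : Type} [Field K] [NumberField K] (hK : IsImaginaryQuadratic K)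
    (hD3 : NumberField.discr K ≠ -3) (hD4 : NumberField.discr K ≠ -4)
    (hH : SatisfiesHeegnerHypothesis N K) {P : (W.baseChange K).toAffine.Point}
    (hP : IsHeegnerPoint N W K P) (hnt : ¬ IsOfFinAddOrder P)
    (hI : padicValNat 5 (AddSubgroup.zmultiples P).index ≤
      padicValNat 5 ((W.baseChange ℚ_[5]).localTamagawaNumber ℤ_[5]))
    (hr : W.analyticRank ≤ 1) {s : ℚ} (hs : shaAn W = (s : ℂ)) (hv : padicValRat 5 s = 0) :
    BSDp W 5 :=
  bsdp_of_jetRowCarrierMult_of_ram 5 Nat.prime_five (by norm_num) 0 0 0 (-412) 3316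
    (by decide +kernel) [(2, 3, 8), (5, 1, 5), (7, 1, 3)]
    (by intro t ht; simp only [List.mem_cons, List.not_mem_nil, or_false] at ht
        rcases ht with rfl | rfl | rfl <;> norm_num)
    (by decide +kernel) (by decide +kernel) (by decide +kernel) (by decide +kernel)
    3 (by norm_num) (by norm_num) (by norm_num) (by decide +kernel) (n := 7) (by decide +kernel)
    (by decide) 7 (by norm_num) (by norm_num) (by decide +kernel) (by decide +kernel) (e := 3)
    (by decide +kernel) (by decide +kernel) (by norm_num) hJ hMcU hGZK hKo hrec hD36 hlev W hW hK hD3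
    hD4 hH hP hnt hI hr hs hv

/-- **`BSD(E,5)` for `280b1` through the bucket-B-mult kit, road O** (same pair; image from the
Frobenius witnesses `(3, 7)` irreducible mod `5` and `(101, 120)` of order `5` (`101 ≡ 1`,
`a₁₀₁ = −18 ≡ 2 (mod 5)`, `25 ∤ 120`) — the (ram)-free, Serre-free road, shown to agree with roads S
and R on a row that has all three). Displayed binders as in `bsdp_jetBmult_280b1_5_serre`.
CONDITIONAL; nothing booked. [cite: Jetchev2008, Cor. 1.5 (p. 812)]
[cite: Cremona2006, Table 1 (label 280b1)] [cite: Serre1972, §2.4 Prop. 15] -/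
theorem bsdp_jetBmult_280b1_5_order
    (hJ : JetchevDivisibilityCarrierMult)
    (hMcU : McCallum1991_padicValNat_card_sha_primary_add_le_of_globalDivisibility)
    (hGZK : rank_eq_analyticRank_of_analyticRank_le_one)
    (hKo : ∀ (N : ℕ) [NeZero N] (W : WeierstrassCurve ℚ) (K : Type) [Field K] [NumberField K],
      kolyvagin N W K)
    (hrec : ∀ (N : ℕ) [NeZero N] (W : WeierstrassCurve ℚ) (K : Type) [Field K] [NumberField K],
      heegnerPointOfConductor_one_galoisConj N W K)
    (hD36 : ∀ (N : ℕ) [NeZero N] (W : WeierstrassCurve ℚ) (K : Type) [Field K] [NumberField K],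
      phi_heegnerTau_mem_singularModuliField N W K)
    (hlev : ∀ {N : ℕ} [NeZero N], IsNewformOf.level_eq_conductorNorm (N := N))
    (W : WeierstrassCurve ℚ) (hW : W = ⟨0, 0, 0, -412, 3316⟩)
    {N : ℕ} [NeZero N] {K : Type} [Field K] [NumberField K] (hK : IsImaginaryQuadratic K)
    (hD3 : NumberField.discr K ≠ -3) (hD4 : NumberField.discr K ≠ -4)
    (hH : SatisfiesHeegnerHypothesis N K) {P : (W.baseChange K).toAffine.Point}
    (hP : IsHeegnerPoint N W K P) (hnt : ¬ IsOfFinAddOrder P)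
    (hI : padicValNat 5 (AddSubgroup.zmultiples P).index ≤
      padicValNat 5 ((W.baseChange ℚ_[5]).localTamagawaNumber ℤ_[5]))
    (hr : W.analyticRank ≤ 1) {s : ℚ} (hs : shaAn W = (s : ℂ)) (hv : padicValRat 5 s = 0) :
    BSDp W 5 :=
  bsdp_of_jetRowCarrierMult_of_irr_of_order 5 Nat.prime_five (by norm_num) 0 0 0 (-412) 3316
    (by decide +kernel) [(2, 3, 8), (5, 1, 5), (7, 1, 3)]
    (by intro t ht; simp only [List.mem_cons, List.not_mem_nil, or_false] at ht
        rcases ht with rfl | rfl | rfl <;> norm_num)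
    (by decide +kernel) (by decide +kernel) (by decide +kernel) (by decide +kernel)
    3 101 (by norm_num) (by norm_num) (by norm_num) (by norm_num) (by norm_num) (by norm_num)
    (by decide +kernel) (by decide +kernel) (n₁ := 7) (n₂ := 120) (by decide +kernel)
    (by decide +kernel) (by decide) (by decide) hJ hMcU hGZK hKo hrec hD36 hlev W hW hK hD3 hD4 hH hP
    hnt hI hr hs hv

end Summit.BirchSwinnertonDyer.Rank1Residual.JET

end
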